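import Literature.NumberTheory.Sieve.GcdQuadraticForm
import Mathlib.NumberTheory.Harmonic.Bounds
import Mathlib.Data.Nat.Totient
import HarnessLib

/-!
# Levinson's Lemma 3.6, `Σ_{k,k' ≤ y} (k,k')/(kk') = O(log³ y)`, and the coincidences `kn = k'n'`

Topic `Literature/NumberTheory/LFunctions`. Everything in this file is PROVED (no definitions, no
named facts).

N. Levinson, *More than one third of zeros of Riemann's zeta-function are on `σ = 1/2`*,
Adv. Math. 13 (1974), Lemma 3.6: "Let `1 ≤ k₁, k₂ ≤ y`, and let `K = (k₁, k₂)`. Then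
`Σ K/(k₁k₂) = O(log³ y)`." With explicit constant:

* `LevinsonSums.sum_sum_gcd_div_mul_le` — `Σ_{1 ≤ k, k' ≤ y} (k,k')/(kk') ≤ (1 + log y)³`
  (`(k,k') = Σ_{d ∣ (k,k')} φ(d)` and Selberg's diagonalisation
  `Literature.NumberTheory.Sieve.sum_sum_mul_mul_apply_gcd` give `Σ_d φ(d) (Σ_{k ≤ y, d ∣ k} 1/k)²`,
  and `Σ_{k ≤ y, d ∣ k} 1/k ≤ (1 + log y)/d`, `φ(d) ≤ d`).

Its use (Levinson §4; Titchmarsh §7.4 for the unmollified case): in the diagonal `kn = k'n'` of the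
mean square of a mollified approximate functional equation
(`Literature/NumberTheory/LFunctions/DirichletPolynomialActivatedMVT.lean`, where the off-diagonal
is bounded in terms of `Σ_{kn = k'n'} |x_{k,n}| |x_{k',n'}|`) one meets the weighted number of
coincidences:

* `LevinsonSums.sum_coincidence_div_le` —
  `Σ_{k,k' ≤ K} Σ_{n,n' ≤ N} [kn = k'n'] / (kn) ≤ (1 + log N)(1 + log K)³`
  (for fixed `k, k', n` there is at most one `n'`; `k' ∣ kn` forces `k'/(k,k') ∣ n`
  (`LevinsonSums.div_gcd_dvd_of_dvd_mul`), and `Σ_{n ≤ N, q ∣ n} 1/n ≤ (1 + log N)/q`).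

## References

* N. Levinson, Adv. Math. 13 (1974), 383–436, §3 Lemma 3.6, §4. [Levinson1974]
* E. C. Titchmarsh, *The Theory of the Riemann Zeta-Function*, 2nd ed. (1986), §7.4. [Titchmarsh1986]
-/

noncomputable section

open Finset Real

namespace Literature.NumberTheory.LFunctions

namespace LevinsonSums

/-! ### Harmonic sums over multiples -/

/-- `Σ_{1 ≤ j ≤ n} 1/j ≤ 1 + log n` (Mathlib's `harmonic_le_one_add_log`). [folklore] -/
theorem sum_Icc_one_div_le (n : ℕ) : ∑ j ∈ Finset.Icc 1 n, (1 : ℝ) / j ≤ 1 + Real.log n := by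
  have h := harmonic_le_one_add_log n
  have e : ((harmonic n : ℚ) : ℝ) = ∑ j ∈ Finset.Icc 1 n, (1 : ℝ) / j := by
    rw [harmonic_eq_sum_Icc]
    push_cast
    exact Finset.sum_congr rfl fun j _ => by rw [one_div]
  rwa [e] at h

/-- The multiples of `d ≥ 1` in `[1, y]` are the `dj`, `1 ≤ j ≤ y/d`. [folklore] -/
theorem filter_dvd_Icc_eq_image {d y : ℕ} (hd : 0 < d) :
    (Finset.Icc 1 y).filter (d ∣ ·) = (Finset.Icc 1 (y / d)).image (d * ·) := by
  ext k
  simp only [Finset.mem_filter, Finset.mem_Icc, Finset.mem_image]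
  constructor
  · rintro ⟨⟨h1, h2⟩, ⟨j, rfl⟩⟩
    refine ⟨j, ⟨?_, ?_⟩, rfl⟩
    · rcases Nat.eq_zero_or_pos j with h | h
      · subst h; simp at h1
      · exact h
    · exact (Nat.le_div_iff_mul_le hd).2 (by rw [mul_comm]; exact h2)
  · rintro ⟨j, ⟨h1, h2⟩, rfl⟩
    refine ⟨⟨Nat.mul_pos hd h1, ?_⟩, dvd_mul_right d j⟩
    have := (Nat.le_div_iff_mul_le hd).1 h2
    rw [mul_comm]; exact this

/-- `Σ_{1 ≤ k ≤ y, d ∣ k} 1/k ≤ (1 + log y)/d` for `d ≥ 1`. [folklore] -/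
theorem sum_filter_dvd_one_div_le {d y : ℕ} (hd : 0 < d) :
    ∑ k ∈ (Finset.Icc 1 y).filter (d ∣ ·), (1 : ℝ) / k ≤ (1 + Real.log y) / d := by
  have hd' : (0 : ℝ) < d := by exact_mod_cast hd
  rw [filter_dvd_Icc_eq_image hd, Finset.sum_image fun a _ b _ h => Nat.eq_of_mul_eq_mul_left hd h]
  have e : ∑ j ∈ Finset.Icc 1 (y / d), (1 : ℝ) / ((d * j : ℕ) : ℝ) =
      (1 / d) * ∑ j ∈ Finset.Icc 1 (y / d), (1 : ℝ) / j := by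
    rw [Finset.mul_sum]
    refine Finset.sum_congr rfl fun j _ => ?_
    push_cast
    rw [one_div_mul_one_div]
  rw [e]
  have hH : ∑ j ∈ Finset.Icc 1 (y / d), (1 : ℝ) / j ≤ 1 + Real.log y := by
    refine (sum_Icc_one_div_le _).trans ?_
    rcases Nat.eq_zero_or_pos (y / d) with h | h
    · rw [h]; simp; positivity
    · have h1 : (0 : ℝ) < ((y / d : ℕ) : ℝ) := by exact_mod_cast h
      have h2 : ((y / d : ℕ) : ℝ) ≤ y := by exact_mod_cast Nat.div_le_self y d
      linarith [Real.log_le_log h1 h2]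
  calc (1 : ℝ) / d * ∑ j ∈ Finset.Icc 1 (y / d), (1 : ℝ) / j ≤ 1 / d * (1 + Real.log y) :=
        mul_le_mul_of_nonneg_left hH (by positivity)
    _ = (1 + Real.log y) / d := by ring

/-! ### Lemma 3.6 -/

/-- **Levinson's Lemma 3.6**: `Σ_{1 ≤ k, k' ≤ y} (k, k')/(k k') ≤ (1 + log y)³`
(`(k,k') = Σ_{d ∣ (k,k')} φ(d)`, Selberg's diagonalisation
`Literature.NumberTheory.Sieve.sum_sum_mul_mul_apply_gcd`, `φ(d) ≤ d` and
`Σ_{k ≤ y, d ∣ k} 1/k ≤ (1 + log y)/d`). [cite: Levinson1974, Lemma 3.6] -/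
theorem sum_sum_gcd_div_mul_le (y : ℕ) :
    ∑ k ∈ Finset.Icc 1 y, ∑ k' ∈ Finset.Icc 1 y, ((Nat.gcd k k' : ℕ) : ℝ) / ((k : ℝ) * k') ≤
      (1 + Real.log y) ^ 3 := by
  classical
  set S : Finset ℕ := Finset.Icc 1 y with hS
  have hS0 : 0 ∉ S := by simp [hS]
  have hlog : 0 ≤ 1 + Real.log y := by
    rcases Nat.eq_zero_or_pos y with h | h
    · rw [h]; simp
    · have : (1 : ℝ) ≤ y := by exact_mod_cast h
      linarith [Real.log_nonneg this]
  -- diagonalisation with `F(n) = n = Σ_{d|n} φ(d)`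
  have hF : ∀ n : ℕ, n ≠ 0 → ∑ d ∈ n.divisors, ((Nat.totient d : ℕ) : ℝ) = (n : ℝ) := by
    intro n _
    exact_mod_cast Nat.sum_totient n
  have key := Literature.NumberTheory.Sieve.sum_sum_mul_mul_apply_gcd S hS0 (fun k => (1 : ℝ) / k)
    (fun d => ((Nat.totient d : ℕ) : ℝ)) (fun n => (n : ℝ)) hF
  have e : ∑ k ∈ S, ∑ k' ∈ S, ((Nat.gcd k k' : ℕ) : ℝ) / ((k : ℝ) * k') =
      ∑ k ∈ S, ∑ k' ∈ S, (1 : ℝ) / k * (1 / k') * ((Nat.gcd k k' : ℕ) : ℝ) := by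
    refine Finset.sum_congr rfl fun k _ => Finset.sum_congr rfl fun k' _ => ?_
    rw [div_eq_mul_one_div, one_div_mul_one_div, mul_comm]
  rw [e, key]
  -- bound each term: `φ(d) (Σ_{d|k} 1/k)² ≤ d ((1+log y)/d)² = (1+log y)²/d`
  set D := S.biUnion Nat.divisors with hD
  have hDsub : D ⊆ S := by
    intro d hd
    rw [hD, Finset.mem_biUnion] at hd
    obtain ⟨h, hh, hdh⟩ := hd
    rw [hS, Finset.mem_Icc] at hh ⊢
    rw [Nat.mem_divisors] at hdh
    exact ⟨Nat.pos_of_dvd_of_pos hdh.1 hh.1, (Nat.le_of_dvd hh.1 hdh.1).trans hh.2⟩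
  have hterm : ∀ d ∈ D, ((Nat.totient d : ℕ) : ℝ) * (∑ h ∈ S.filter (d ∣ ·), (1 : ℝ) / h) ^ 2 ≤
      (1 + Real.log y) ^ 2 * (1 / d) := by
    intro d hd
    have hdS := hDsub hd
    rw [hS, Finset.mem_Icc] at hdS
    have hd0 : 0 < d := hdS.1
    have hd' : (0 : ℝ) < d := by exact_mod_cast hd0
    have h1 : ((Nat.totient d : ℕ) : ℝ) ≤ d := by exact_mod_cast Nat.totient_le d
    have h2 : ∑ h ∈ S.filter (d ∣ ·), (1 : ℝ) / h ≤ (1 + Real.log y) / d :=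
      sum_filter_dvd_one_div_le hd0
    have h3 : 0 ≤ ∑ h ∈ S.filter (d ∣ ·), (1 : ℝ) / h :=
      Finset.sum_nonneg fun h _ => by positivity
    calc ((Nat.totient d : ℕ) : ℝ) * (∑ h ∈ S.filter (d ∣ ·), (1 : ℝ) / h) ^ 2
        ≤ d * ((1 + Real.log y) / d) ^ 2 := by
          apply mul_le_mul h1 (pow_le_pow_left₀ h3 h2 2) (sq_nonneg _) hd'.le
      _ = (1 + Real.log y) ^ 2 * (1 / d) := by field_simp
  calc ∑ d ∈ D, ((Nat.totient d : ℕ) : ℝ) * (∑ h ∈ S.filter (d ∣ ·), (1 : ℝ) / h) ^ 2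
      ≤ ∑ d ∈ D, (1 + Real.log y) ^ 2 * (1 / d) := Finset.sum_le_sum hterm
    _ ≤ ∑ d ∈ S, (1 + Real.log y) ^ 2 * (1 / d) :=
        Finset.sum_le_sum_of_subset_of_nonneg hDsub fun d _ _ => by positivity
    _ = (1 + Real.log y) ^ 2 * ∑ d ∈ S, (1 : ℝ) / d := by rw [Finset.mul_sum]
    _ ≤ (1 + Real.log y) ^ 2 * (1 + Real.log y) :=
        mul_le_mul_of_nonneg_left (sum_Icc_one_div_le y) (by positivity)
    _ = (1 + Real.log y) ^ 3 := by ring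

/-! ### Coincidences `kn = k'n'` -/

/-- `k' ∣ kn` forces `k'/(k,k') ∣ n`. [folklore] -/
theorem div_gcd_dvd_of_dvd_mul {k k' n : ℕ} (hk : 0 < k) (h : k' ∣ k * n) :
    k' / Nat.gcd k k' ∣ n := by
  set g := Nat.gcd k k' with hg
  have hg0 : 0 < g := Nat.gcd_pos_of_pos_left _ hk
  have hcop : Nat.Coprime (k' / g) (k / g) := by
    have := Nat.coprime_div_gcd_div_gcd (m := k) (n := k') hg0
    exact this.symm
  have h1 : k' / g ∣ (k / g) * n := by
    have hk' : k' = g * (k' / g) := (Nat.mul_div_cancel' (Nat.gcd_dvd_right k k')).symm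
    have hkk : k = g * (k / g) := (Nat.mul_div_cancel' (Nat.gcd_dvd_left k k')).symm
    rw [hk', hkk, mul_assoc] at h
    exact Nat.dvd_of_mul_dvd_mul_left hg0 h
  exact hcop.dvd_of_dvd_mul_left h1

/-- **The coincidence sum**: for `K, N ≥ 0`,
`Σ_{k,k' ≤ K} Σ_{n,n' ≤ N} [kn = k'n'] / (kn) ≤ (1 + log N)(1 + log K)³`
(for fixed `k, k', n` at most one `n'`, and `k' ∣ kn` forces `k'/(k,k') ∣ n`, so the sum is at most
`Σ_{k,k'} (1/k) Σ_{n ≤ N, (k'/(k,k')) ∣ n} 1/n ≤ (1 + log N) Σ_{k,k'} (k,k')/(kk')`, and Lemma 3.6).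
This bounds the number (weighted by `1/m`) of representations `m = kn = k'n'` met in the diagonal
of the mean square of a mollified approximate functional equation
(`DirichletPolynomialActivatedMVT.lean`). [cite: Levinson1974, Lemma 3.6] -/
theorem sum_coincidence_div_le (K N : ℕ) :
    ∑ k ∈ Finset.Icc 1 K, ∑ k' ∈ Finset.Icc 1 K, ∑ n ∈ Finset.Icc 1 N, ∑ n' ∈ Finset.Icc 1 N,
        (if k * n = k' * n' then (1 : ℝ) / ((k : ℝ) * n) else 0) ≤
      (1 + Real.log N) * (1 + Real.log K) ^ 3 := by
  classical
  have hlogN : 0 ≤ 1 + Real.log N := by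
    rcases Nat.eq_zero_or_pos N with h | h
    · rw [h]; simp
    · have : (1 : ℝ) ≤ N := by exact_mod_cast h
      linarith [Real.log_nonneg this]
  -- the innermost sum has at most one non-zero term
  have hinner : ∀ k ∈ Finset.Icc 1 K, ∀ k' ∈ Finset.Icc 1 K, ∀ n ∈ Finset.Icc 1 N,
      ∑ n' ∈ Finset.Icc 1 N, (if k * n = k' * n' then (1 : ℝ) / ((k : ℝ) * n) else 0) ≤
        if k' / Nat.gcd k k' ∣ n then (1 : ℝ) / ((k : ℝ) * n) else 0 := by
    intro k hk k' hk' n hn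
    rw [Finset.mem_Icc] at hk hk' hn
    have hpos : 0 ≤ (1 : ℝ) / ((k : ℝ) * n) := by positivity
    by_cases hdvd : k' ∣ k * n
    · rw [if_pos (div_gcd_dvd_of_dvd_mul hk.1 hdvd)]
      -- at most the single term `n' = kn/k'`
      calc ∑ n' ∈ Finset.Icc 1 N, (if k * n = k' * n' then (1 : ℝ) / ((k : ℝ) * n) else 0)
          ≤ ∑ n' ∈ ({k * n / k'} : Finset ℕ), (1 : ℝ) / ((k : ℝ) * n) := by
            rw [← Finset.sum_filter]
            refine Finset.sum_le_sum_of_subset_of_nonneg ?_ fun _ _ _ => hpos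
            intro n' hn'
            rw [Finset.mem_filter] at hn'
            rw [Finset.mem_singleton, hn'.2, Nat.mul_div_cancel_left _ hk'.1]
        _ = (1 : ℝ) / ((k : ℝ) * n) := Finset.sum_singleton _ _
    · have hzero : ∀ n' ∈ Finset.Icc 1 N, (if k * n = k' * n' then (1 : ℝ) / ((k : ℝ) * n) else 0) = 0 := by
        intro n' _
        rw [if_neg]
        intro h
        exact hdvd ⟨n', h⟩
      rw [Finset.sum_congr rfl hzero, Finset.sum_const_zero]
      split_ifs <;> positivity
  -- sum over `n` of the divisibility indicator
  have hmid : ∀ k ∈ Finset.Icc 1 K, ∀ k' ∈ Finset.Icc 1 K,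
      ∑ n ∈ Finset.Icc 1 N, (if k' / Nat.gcd k k' ∣ n then (1 : ℝ) / ((k : ℝ) * n) else 0) ≤
        (1 + Real.log N) * (((Nat.gcd k k' : ℕ) : ℝ) / ((k : ℝ) * k')) := by
    intro k hk k' hk'
    rw [Finset.mem_Icc] at hk hk'
    set g := Nat.gcd k k' with hg
    have hg0 : 0 < g := Nat.gcd_pos_of_pos_left _ hk.1
    have hq0 : 0 < k' / g := Nat.div_pos (Nat.le_of_dvd hk'.1 (Nat.gcd_dvd_right k k')) hg0
    have hk0 : (0 : ℝ) < k := by exact_mod_cast hk.1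
    have hk'0 : (0 : ℝ) < k' := by exact_mod_cast hk'.1
    rw [← Finset.sum_filter]
    have e : ∑ n ∈ (Finset.Icc 1 N).filter (k' / g ∣ ·), (1 : ℝ) / ((k : ℝ) * n) =
        (1 / k) * ∑ n ∈ (Finset.Icc 1 N).filter (k' / g ∣ ·), (1 : ℝ) / n := by
      rw [Finset.mul_sum]
      refine Finset.sum_congr rfl fun n _ => ?_
      rw [one_div_mul_one_div]
    rw [e]
    have h1 := sum_filter_dvd_one_div_le (y := N) hq0
    have hq : ((k' / g : ℕ) : ℝ) = (k' : ℝ) / g := by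
      rw [Nat.cast_div (Nat.gcd_dvd_right k k') (by exact_mod_cast hg0.ne')]
    rw [hq] at h1
    calc (1 : ℝ) / k * ∑ n ∈ (Finset.Icc 1 N).filter (k' / g ∣ ·), (1 : ℝ) / n
        ≤ 1 / k * ((1 + Real.log N) / ((k' : ℝ) / g)) :=
          mul_le_mul_of_nonneg_left h1 (by positivity)
      _ = (1 + Real.log N) * ((g : ℝ) / ((k : ℝ) * k')) := by
          field_simp
  -- assemble with Lemma 3.6
  calc _ ≤ ∑ k ∈ Finset.Icc 1 K, ∑ k' ∈ Finset.Icc 1 K, ∑ n ∈ Finset.Icc 1 N,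
        (if k' / Nat.gcd k k' ∣ n then (1 : ℝ) / ((k : ℝ) * n) else 0) :=
        Finset.sum_le_sum fun k hk => Finset.sum_le_sum fun k' hk' =>
          Finset.sum_le_sum fun n hn => hinner k hk k' hk' n hn
    _ ≤ ∑ k ∈ Finset.Icc 1 K, ∑ k' ∈ Finset.Icc 1 K,
        (1 + Real.log N) * (((Nat.gcd k k' : ℕ) : ℝ) / ((k : ℝ) * k')) :=
        Finset.sum_le_sum fun k hk => Finset.sum_le_sum fun k' hk' => hmid k hk k' hk'
    _ = (1 + Real.log N) * ∑ k ∈ Finset.Icc 1 K, ∑ k' ∈ Finset.Icc 1 K,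
        ((Nat.gcd k k' : ℕ) : ℝ) / ((k : ℝ) * k') := by
        rw [Finset.mul_sum]
        refine Finset.sum_congr rfl fun k _ => ?_
        rw [Finset.mul_sum]
    _ ≤ (1 + Real.log N) * (1 + Real.log K) ^ 3 :=
        mul_le_mul_of_nonneg_left (sum_sum_gcd_div_mul_le K) hlogN

end LevinsonSums

end Literature.NumberTheory.LFunctions
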